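import Literature.MathematicalPhysics.QuantumFieldTheory.Balaban1983to89.T4HistoryLipschitzCubeGeometry
import Summits.QuantumFields.BalabanUV.T4Continuum.Support.NE9BridgeSizeInduction
import Summits.QuantumFields.BalabanUV.T4Continuum.Support.B13CarriersCubeChart

/-!
# T⁴ programme, spine estimate NE9 (node U3, history side) — the END faces OVER A CUBE CHART (geometry leaves L-G1∕L-G2
# discharged) and ON THE CARRIERS OF RECORD `B13Carriers.TwoRuns.carriers`

NE9 formalisation swarm `t4-ne9-formalise-*` (cell `pub-balaban`), seat `b2b-balaban-t4-ne9-formalise-leaf-02-g2` (LEAF PROVER 02,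
gen 2), micro-item G-REC of the journal (claim 2026-08-20T06:29Z; rows L-G1∕L-G2 of `t4/formal/NE9/DAG.md` §1B, there «DONE (P2)
modulo O1's identification of d with Bałaban's d_k»).  Summits-side NEW WORK (bookkeeping only) under the LEAN PLACEMENT RULE;
nothing of the imported modules is edited, every END face is APPLIED BY NAME.

WHY.  The row's END faces — END-B `NE9LastCouplingBridge.ne9_and_fadingMemory_of_couplingTwoPoint`, END-V
`NE9VacuumSubtractedBridge.ne9_and_fadingMemory_of_couplingTwoPoint_vacSub`, END-S
`NE9BridgeSizeInduction.ne9_and_fadingMemory_of_couplingTwoPoint_sizeInduction` ∕ `…_vacSub_sizeInduction` — are stated over an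
ABSTRACT cluster geometry `G : ClusterGeom C` and display the two geometry leaves L-G1 `hdec : G.DecayExtract δ d` ([II] (2.27)
TYPE) and L-G2 `hpin : G.PinBudget a δ (fun _ => B) κ` ([II] (2.40)→(2.41) TYPE).  Road P2 PROVED both for the CONSTRUCTED geometry
`Γ.geom` of any cube chart `Γ : CubeChart C α adj D` (`T4HistoryLipschitzCubeGeometry.CubeChart.decayExtract` ∕ `CubeChart.pinBudget`:
size weights `a = sizeWeight a₁`, `d = sizeWeight d₁` per cube, extracted decay `δ X = d₁·#cubes X`, CONSTANT pin envelope `B = a₁`,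
under `0 ≤ a₁`, `0 ≤ κ ≤ d₁` and the chart's comparability `d X ≤ #cubes X` = upper half of [II] (2.30)).  The NE5 swarm has now put
NE9's cube chart ON THE CARRIERS OF RECORD: `B13CarriersCubeChart.cubeChart R : CubeChart R.carriers (SCube R) (SAdj R) 8` for every
`R : B13Carriers.TwoRuns G` (cubes = the embedded footprints of `B13DomainGeometryTR`, `d_le` from `TwoRuns.d_le_card_sub_one`).
§1 composes the four END faces with the two cube-chart theorems for ANY chart (L-G1∕L-G2 GONE; three scalars remain); §2
specialises §1 to `Γ := cubeChart R`: NE9's END faces for term functionals `E : Functional R.carriers Bg` on the SAME `Carriers` as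
row NE5's END faces — the shape node U3's `T4OutputRate.u3_threeBrackets` consumes (NE9 ∧ LipBackground ∧ NE5 on ONE carriers).

WHAT IS PROVED (kernel; every theorem a one-line application of landed theorems BY NAME):
* §1 `cubeChart_ne9_and_fadingMemory_of_couplingTwoPoint` (END-B over `Γ.geom`), `…_vacSub` (END-V), `cubeChart_termSize_…_sizeInduction`
  (END-S), `cubeChart_termSize_…_vacSub_sizeInduction` (END-S, vacuum-subtracted): conclusions LITERALLY those of the END faces with
  the pin budget `B` READ AS the Kotecký–Preiss size constant `a₁` per cube, e.g. `NE9 E W κ (prodModuli (4·clipbar·a₁ + pexbar +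
  4·lipbar·a₁·qTbar) fun _ => ω + 4·lipbar·a₁·τbar) ∧ FadingMemory (…) (ω + 4·lipbar·a₁·τbar) (…)`.
* §2 `rec_ne9_and_fadingMemory_of_couplingTwoPoint` (END-B on `R.carriers` at `(cubeChart R).geom`) and
  `rec_termSize_ne9_and_fadingMemory_of_couplingTwoPoint_vacSub_sizeInduction` (the END face displaying NEITHER an explicit-part
  modulus NOR an occupation hypothesis, on `R.carriers`).
Every other binder is DISPLAYED VERBATIM (leaf-labelled as in `Spine/NE9/LeafIndex`): L-O1 (the one-step cluster representation's
activities `act`, channel `T`, reading `ρ`, tables `𝒜`, majorant `n` — cell-wide NODE O, constructed by nobody yet), L-S1…L-S5,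
L-A1…L-A4, L-R1, L-R2 (or its size-induction replacement), L-N1.  Trigger c3 respected: no `def … : Prop` is minted; the (R-1) chain
(2.15)→(2.38) is asserted by nobody; nothing printed in [I]∕[II] is used as a hypothesis-free fact; constants symbolic (c6).

CUBE-CURRENCY RIDER (v1.1; row owner's ruling 2026-08-20T06:44:46Z accepting this micro-item as crew row (w12), rider (a); FINDING
F-ne9leaf01-1, kernel `Support/NE9CubeCurrencyBudget` p208845).  The faces below discharge L-G1∕L-G2 with road P2's CUBE-COUNT
producers: decay weight `d₁` PER CUBE with `κ ≤ d₁`, pin budget `a₁` per cube.  Any producer of the remaining Kotecký–Preiss binder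
`hK` in the same currency (the E2∕E5-type binders `hθ`, `hεθ`, `hθ₁`, `hliplb` of `T4HistoryLipschitzLinearSize` ∕
`NE9PrintedMajorantDecay`) then pays (R) the RATE DIVISION `κ ≤ a′∕2^ν − a₁ − 1 − log(2D)` and (P) the factor
`e^{a(1−2^{−ν}) + a′(1−2^{−ν})}` in the fading product (`NE9CubeCurrencyBudget.rate_budget` ∕ `fade_necessary`) — located costs of the
cube currency, not of the mathematics; the d-currency producers of crew row (w13) (F8) remove them.  Until (w13) lands, every use of
these faces inherits (R)∕(P).  Rider (b) = the sibling `Spine/NE9/CarriersOfRecordFacesProj` (marginal-projection faces); rider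
(c): headline «L-G1∕L-G2 inhabited on the carriers of record (cube currency)», never «NE9 instantiated» ([II] §2's objects untyped, O1).

HONEST FRAMING: rung (B)+1 bookkeeping on a FIXED finite four-torus.  After this file the geometry leaves L-G1∕L-G2 are inhabited on
the carriers of record (in cube currency); the analytic leaves are untouched; NE9 is NOT PRINTED and NOT PROVED — every headline reads «NE9 ⇐ the named
binders»; NOT UV stability, NOT the continuum limit by itself, NOT infinite volume, NOT a mass gap, NOT Clay; spine PROVED 0∕9
unchanged.  HONEST DEPENDENCY: continuum YM on T⁴ ⇐ BetaPertH ∧ nine spine estimates (0/9 proved); BetaPertH ⇐ (D1) ∧ (D4) ∧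
CAP+tail; G-an2-4 gates asym, D1 and NE2/3/4.

References (TYPES∕STRUCTURE only): [I] = [Balaban1987RG1] (0.23) p.256, (1.18) p.263, (2.12)–(2.14) p.268, p.257 (cubes and walls); [II] =
[Balaban1988RG2Cluster] (1.36) p.9, (2.11)–(2.15) pp.14–15, (2.27), (2.30) p.18, Lemma 3 (2.38) p.20, (2.40)–(2.41) p.21; [KoteckyPreiss1986] (1)–(4).
-/

noncomputable section

namespace Summit.QuantumFields.BalabanUV.T4Continuum.NE9.CarriersOfRecordFaces

open scoped BigOperators
open Literature.MathematicalPhysics.QuantumFieldTheory.Balaban1983to89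
open Literature.MathematicalPhysics.QuantumFieldTheory.Balaban1983to89.T4OutputRate
open Literature.MathematicalPhysics.QuantumFieldTheory.Balaban1983to89.T4HistoryLipschitzRecursion
open Literature.MathematicalPhysics.QuantumFieldTheory.Balaban1983to89.T4HistoryLipschitzOuter
open Literature.MathematicalPhysics.QuantumFieldTheory.Balaban1983to89.T4HistoryLipschitzActivity
open Literature.MathematicalPhysics.QuantumFieldTheory.Balaban1983to89.T4HistoryLipschitzActivity (ClusterGeom)
open Literature.MathematicalPhysics.QuantumFieldTheory.Balaban1983to89.T4HistoryLipschitzEntropy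
open Literature.MathematicalPhysics.QuantumFieldTheory.Balaban1983to89.T4HistoryLipschitzSegment
open Literature.MathematicalPhysics.QuantumFieldTheory.Balaban1983to89.T4HistoryLipschitzCubeGeometry (CubeChart)
open Summit.QuantumFields.BalabanUV.T4Continuum.NE9LastCouplingBridge
open Summit.QuantumFields.BalabanUV.T4Continuum.NE9VacuumSubtractedBridge
open Summit.QuantumFields.BalabanUV.T4Continuum.NE9BridgeSizeInduction
open Summit.QuantumFields.BalabanUV.T4Continuum.B13Carriers (TwoRuns)
open Summit.QuantumFields.BalabanUV.T4Continuum.B13DomainGeometryTR (SCube SAdj)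
open Summit.QuantumFields.BalabanUV.T4Continuum.B13CarriersCubeChart (cubeChart)

/-! ## §1 The four END faces over a CUBE CHART: leaves L-G1∕L-G2 discharged by `CubeChart.decayExtract` ∕ `CubeChart.pinBudget` -/

section AnyChart

variable {C : Carriers} {Bg : Type} {Pot : Type*} [NormedAddCommGroup Pot] [NormedSpace ℂ Pot]
  {α : Type} [DecidableEq α] {adj : α → α → Prop} [DecidableRel adj] [Std.Symm adj] {D : ℕ}

/-- **END-B OVER A CUBE CHART** [bookkeeping] — `NE9LastCouplingBridge.ne9_and_fadingMemory_of_couplingTwoPoint` at the constructed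
geometry `Γ.geom` with CUBE-COUNT size weights `a = Γ.supported.sizeWeight a₁`, `d = Γ.supported.sizeWeight d₁`: the geometry leaves
L-G1 (`DecayExtract`, [II] (2.27) TYPE) and L-G2 (`PinBudget`, [II] (2.40)→(2.41) TYPE) are DISCHARGED by `CubeChart.decayExtract` ∕
`CubeChart.pinBudget`; what remains of them is `0 ≤ a₁`, `0 ≤ κ ≤ d₁`, and the pin budget of the END is `B = a₁`.  All other binders
displayed verbatim (leaf ids as in `Spine/NE9/LeafIndex`). -/
theorem cubeChart_ne9_and_fadingMemory_of_couplingTwoPoint (Γ : CubeChart C α adj D) {ι : Type} {E : Functional C Bg}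
    {W : Set (ℕ → ℝ)} {Adm : Set (Bg → C.Dom → ℝ)} {T : ℕ → (ℕ → ℝ) → (Bg → C.Dom → ℝ) → ι → ℝ}
    {Ψ : ℕ → ℝ → (ι → ℝ) → Bg → C.Dom → ℝ} {act : ℕ → ℝ → Bg → Pot → Γ.geom.P → ℂ} {𝒜 : ℕ → Set Pot}
    {n : ℕ → ℝ → Bg → Γ.geom.P → ℝ} {lip clip : ℕ → ℝ}
    {a₁ d₁ κ lipbar clipbar pexbar qTbar τbar ω : ℝ} {wt : ℕ → ι → ℝ} {τ : ℕ → ℕ → ℝ} {pex qT : ℕ → ℝ}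
    (ρ : ℕ → (ι → ℝ) → Pot) (expl : ℕ → ℝ → Bg → C.Dom → ℝ)
    -- L-S1 … L-S4 (printed STRUCTURE of the one-step cluster representation, on the model O1)
    (h0 : ScaleZeroFree E W) (hAdm : AdmissibleTerms E W Adm) (hres : AdmRestrict Adm)
    (hadd : ChannelAdditive Adm T) (hsum : ChannelStepSum Adm T) (hfac : Factorises E W T Ψ)
    (hrepr : ∀ (k : ℕ) (s : ℝ) (P : ι → ℝ) (U : Bg) (X : C.Dom),
      Ψ k s P U X = (Γ.geom.newTerm act k s U X (ρ k P)).re + expl k s U X)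
    -- L-S5 ([II] Lemma 1 (1.36) TYPE per creation step — displayed, c3)
    (hstep : ChannelSizeAtStepNN Adm T κ wt τ) (hτ : ∀ k j, j ≤ k → 0 ≤ τ k j ∧ τ k j ≤ τbar * ω ^ (k - j))
    -- L-A1 with cube-count size weights (reductions landed; residual (R-1) = WALL, asserted by nobody)
    (hK : TwoPointKP Γ.geom W act 𝒜 n lip (Γ.supported.sizeWeight a₁) (Γ.supported.sizeWeight d₁))
    (hlipb : ∀ k, lip k ≤ lipbar)
    -- L-A2 coupling two-point at the activity level
    (hclip0 : ∀ k, 0 ≤ clip k)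
    (hCup : ∀ g ∈ W, ∀ g' ∈ W, ∀ (k : ℕ) (U : Bg) (X : C.Dom), C.scale X = k + 1 → ∀ Q ∈ 𝒜 k, ∀ γ ∈ Γ.geom.vol X,
      ‖act k (g k) U Q γ‖ ≤ n k (g' k) U γ ∧
        ‖act k (g k) U Q γ - act k (g' k) U Q γ‖ ≤ clip k * |g k - g' k| * n k (g' k) U γ)
    (hclipb : ∀ k, clip k ≤ clipbar)
    -- L-A3 channel coupling modulus
    (hqT0 : ∀ k, 0 ≤ qT k)
    (hTcup : ∀ g ∈ W, ∀ g' ∈ W, ∀ (k : ℕ) (y : ι), |T k g (E g) y - T k g' (E g) y| ≤ wt k y * (qT k * |g k - g' k|))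
    (hqTb : ∀ k, qT k ≤ qTbar)
    -- L-A4 the explicit part's last-coupling modulus
    (hexpl : ∀ g ∈ W, ∀ g' ∈ W, ∀ (k : ℕ) (U : Bg) (X : C.Dom), C.scale X = k + 1 →
      |expl k (g k) U X - expl k (g' k) U X| ≤ Real.exp (-(κ * C.d X)) * (pex k * |g k - g' k|))
    (hpexb : ∀ k, pex k ≤ pexbar) (hpexbar : 0 ≤ pexbar)
    -- L-G1 ∕ L-G2 DISCHARGED on the chart: the three scalars of `CubeChart.decayExtract` ∕ `CubeChart.pinBudget`
    (ha₁ : 0 ≤ a₁) (hκ : 0 ≤ κ) (hκd : κ ≤ d₁)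
    -- L-R1 reading law, L-R2 occupation, L-N1 scalars
    (hρ : ∀ (k : ℕ) (P P' : ι → ℝ) (M : ℝ), (∀ y, |P y - P' y| ≤ wt k y * M) → ‖ρ k P - ρ k P'‖ ≤ M)
    (hocc : ∀ g ∈ W, ∀ g' ∈ W, ∀ k : ℕ, ρ k (T k g' (E g)) ∈ 𝒜 k)
    (hτbar : 0 ≤ τbar) (hω : 0 ≤ ω) (hpos : 0 < ω + 4 * lipbar * a₁ * τbar) :
    NE9 E W κ (prodModuli (4 * clipbar * a₁ + pexbar + 4 * lipbar * a₁ * qTbar) fun _ => ω + 4 * lipbar * a₁ * τbar) ∧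
      FadingMemory ((4 * clipbar * a₁ + pexbar + 4 * lipbar * a₁ * qTbar) / (ω + 4 * lipbar * a₁ * τbar))
        (ω + 4 * lipbar * a₁ * τbar)
        (prodModuli (4 * clipbar * a₁ + pexbar + 4 * lipbar * a₁ * qTbar) fun _ => ω + 4 * lipbar * a₁ * τbar) :=
  ne9_and_fadingMemory_of_couplingTwoPoint Γ.geom ρ expl h0 hAdm hres hadd hsum hstep hfac hclip0 hCup hqT0 hTcup hrepr hexpl
    hclipb hpexb hpexbar hqTb hK (Γ.decayExtract (hκ.trans hκd)) (Γ.pinBudget ha₁ hκ hκd) hρ hocc ha₁ hlipb hτbar hω hpos hτ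

/-- **END-V OVER A CUBE CHART** [bookkeeping] — `NE9VacuumSubtractedBridge.ne9_and_fadingMemory_of_couplingTwoPoint_vacSub` at
`Γ.geom` with cube-count size weights; L-G1∕L-G2 discharged (scalars `0 ≤ a₁`, `0 ≤ κ ≤ d₁`; pin budget `B = a₁`), leaf L-A4 gone
(vacuum-subtracted representation), constants 8. -/
theorem cubeChart_ne9_and_fadingMemory_of_couplingTwoPoint_vacSub (Γ : CubeChart C α adj D) {ι : Type} {E : Functional C Bg}
    {W : Set (ℕ → ℝ)} {Adm : Set (Bg → C.Dom → ℝ)} {T : ℕ → (ℕ → ℝ) → (Bg → C.Dom → ℝ) → ι → ℝ}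
    {Ψ : ℕ → ℝ → (ι → ℝ) → Bg → C.Dom → ℝ} {act : ℕ → ℝ → Bg → Pot → Γ.geom.P → ℂ} {𝒜 : ℕ → Set Pot}
    {n : ℕ → ℝ → Bg → Γ.geom.P → ℝ} {lip clip : ℕ → ℝ}
    {a₁ d₁ κ lipbar clipbar qTbar τbar ω : ℝ} {wt : ℕ → ι → ℝ} {τ : ℕ → ℕ → ℝ} {qT : ℕ → ℝ}
    (ρ : ℕ → (ι → ℝ) → Pot) (U₀ : Bg) (explZ : ℕ → Bg → C.Dom → ℝ)
    -- L-S1 … L-S4 (vacuum-subtracted representation)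
    (h0 : ScaleZeroFree E W) (hAdm : AdmissibleTerms E W Adm) (hres : AdmRestrict Adm)
    (hadd : ChannelAdditive Adm T) (hsum : ChannelStepSum Adm T) (hfac : Factorises E W T Ψ)
    (hreprV : ∀ (k : ℕ) (s : ℝ) (P : ι → ℝ) (U : Bg) (X : C.Dom),
      Ψ k s P U X = (Γ.geom.newTerm act k s U X (ρ k P)).re - (Γ.geom.newTerm act k s U₀ X (ρ k P)).re + explZ k U X)
    -- L-S5
    (hstep : ChannelSizeAtStepNN Adm T κ wt τ) (hτ : ∀ k j, j ≤ k → 0 ≤ τ k j ∧ τ k j ≤ τbar * ω ^ (k - j))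
    -- L-A1
    (hK : TwoPointKP Γ.geom W act 𝒜 n lip (Γ.supported.sizeWeight a₁) (Γ.supported.sizeWeight d₁))
    (hlipb : ∀ k, lip k ≤ lipbar)
    -- L-A2
    (hclip0 : ∀ k, 0 ≤ clip k)
    (hCup : ∀ g ∈ W, ∀ g' ∈ W, ∀ (k : ℕ) (U : Bg) (X : C.Dom), C.scale X = k + 1 → ∀ Q ∈ 𝒜 k, ∀ γ ∈ Γ.geom.vol X,
      ‖act k (g k) U Q γ‖ ≤ n k (g' k) U γ ∧
        ‖act k (g k) U Q γ - act k (g' k) U Q γ‖ ≤ clip k * |g k - g' k| * n k (g' k) U γ)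
    (hclipb : ∀ k, clip k ≤ clipbar)
    -- L-A3
    (hqT0 : ∀ k, 0 ≤ qT k)
    (hTcup : ∀ g ∈ W, ∀ g' ∈ W, ∀ (k : ℕ) (y : ι), |T k g (E g) y - T k g' (E g) y| ≤ wt k y * (qT k * |g k - g' k|))
    (hqTb : ∀ k, qT k ≤ qTbar)
    -- L-G1 ∕ L-G2 DISCHARGED
    (ha₁ : 0 ≤ a₁) (hκ : 0 ≤ κ) (hκd : κ ≤ d₁)
    -- L-R1, L-R2, L-N1
    (hρ : ∀ (k : ℕ) (P P' : ι → ℝ) (M : ℝ), (∀ y, |P y - P' y| ≤ wt k y * M) → ‖ρ k P - ρ k P'‖ ≤ M)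
    (hocc : ∀ g ∈ W, ∀ g' ∈ W, ∀ k : ℕ, ρ k (T k g' (E g)) ∈ 𝒜 k)
    (hτbar : 0 ≤ τbar) (hω : 0 ≤ ω) (hpos : 0 < ω + 8 * lipbar * a₁ * τbar) :
    NE9 E W κ (prodModuli (8 * clipbar * a₁ + 8 * lipbar * a₁ * qTbar) fun _ => ω + 8 * lipbar * a₁ * τbar) ∧
      FadingMemory ((8 * clipbar * a₁ + 8 * lipbar * a₁ * qTbar) / (ω + 8 * lipbar * a₁ * τbar))
        (ω + 8 * lipbar * a₁ * τbar)
        (prodModuli (8 * clipbar * a₁ + 8 * lipbar * a₁ * qTbar) fun _ => ω + 8 * lipbar * a₁ * τbar) :=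
  ne9_and_fadingMemory_of_couplingTwoPoint_vacSub Γ.geom ρ U₀ explZ h0 hAdm hres hadd hsum hstep hfac hclip0 hCup hqT0 hTcup
    hreprV hclipb hqTb hK (Γ.decayExtract (hκ.trans hκd)) (Γ.pinBudget ha₁ hκ hκd) hρ hocc ha₁ hlipb hτbar hω hpos hτ

/-- **END-S OVER A CUBE CHART (representation with an explicit part)** [bookkeeping] —
`NE9BridgeSizeInduction.ne9_and_fadingMemory_of_couplingTwoPoint_sizeInduction` at `Γ.geom` with cube-count size weights; L-G1∕L-G2
discharged; the occupation leaf L-R2 REPLACED by the one-run size data (B0) `hbase`, (X) `hexplSize`, (N) `hNsucc : p₀ j + a₁ ≤ N (j+1)`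
(the pin budget IS the per-cube size constant), `hNnn`, (R′) `hbox`; returns the term size bound `TermSize E W κ N` as well. -/
theorem cubeChart_termSize_ne9_and_fadingMemory_of_couplingTwoPoint_sizeInduction (Γ : CubeChart C α adj D) {ι : Type}
    {E : Functional C Bg} {W : Set (ℕ → ℝ)} {Adm : Set (Bg → C.Dom → ℝ)} {T : ℕ → (ℕ → ℝ) → (Bg → C.Dom → ℝ) → ι → ℝ}
    {Ψ : ℕ → ℝ → (ι → ℝ) → Bg → C.Dom → ℝ} {act : ℕ → ℝ → Bg → Pot → Γ.geom.P → ℂ} {𝒜 : ℕ → Set Pot}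
    {n : ℕ → ℝ → Bg → Γ.geom.P → ℝ} {lip clip : ℕ → ℝ}
    {a₁ d₁ κ lipbar clipbar pexbar qTbar τbar ω : ℝ} {wt : ℕ → ι → ℝ} {τ : ℕ → ℕ → ℝ} {pex qT p₀ N : ℕ → ℝ}
    (ρ : ℕ → (ι → ℝ) → Pot) (expl : ℕ → ℝ → Bg → C.Dom → ℝ)
    -- L-S1 … L-S4
    (h0 : ScaleZeroFree E W) (hAdm : AdmissibleTerms E W Adm) (hres : AdmRestrict Adm)
    (hadd : ChannelAdditive Adm T) (hsum : ChannelStepSum Adm T) (hfac : Factorises E W T Ψ)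
    (hrepr : ∀ (k : ℕ) (s : ℝ) (P : ι → ℝ) (U : Bg) (X : C.Dom),
      Ψ k s P U X = (Γ.geom.newTerm act k s U X (ρ k P)).re + expl k s U X)
    -- L-S5
    (hstep : ChannelSizeAtStepNN Adm T κ wt τ) (hτ : ∀ k j, j ≤ k → 0 ≤ τ k j ∧ τ k j ≤ τbar * ω ^ (k - j))
    -- L-A1
    (hK : TwoPointKP Γ.geom W act 𝒜 n lip (Γ.supported.sizeWeight a₁) (Γ.supported.sizeWeight d₁))
    (hlipb : ∀ k, lip k ≤ lipbar)
    -- L-A2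
    (hclip0 : ∀ k, 0 ≤ clip k)
    (hCup : ∀ g ∈ W, ∀ g' ∈ W, ∀ (k : ℕ) (U : Bg) (X : C.Dom), C.scale X = k + 1 → ∀ Q ∈ 𝒜 k, ∀ γ ∈ Γ.geom.vol X,
      ‖act k (g k) U Q γ‖ ≤ n k (g' k) U γ ∧
        ‖act k (g k) U Q γ - act k (g' k) U Q γ‖ ≤ clip k * |g k - g' k| * n k (g' k) U γ)
    (hclipb : ∀ k, clip k ≤ clipbar)
    -- L-A3
    (hqT0 : ∀ k, 0 ≤ qT k)
    (hTcup : ∀ g ∈ W, ∀ g' ∈ W, ∀ (k : ℕ) (y : ι), |T k g (E g) y - T k g' (E g) y| ≤ wt k y * (qT k * |g k - g' k|))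
    (hqTb : ∀ k, qT k ≤ qTbar)
    -- L-A4
    (hexpl : ∀ g ∈ W, ∀ g' ∈ W, ∀ (k : ℕ) (U : Bg) (X : C.Dom), C.scale X = k + 1 →
      |expl k (g k) U X - expl k (g' k) U X| ≤ Real.exp (-(κ * C.d X)) * (pex k * |g k - g' k|))
    (hpexb : ∀ k, pex k ≤ pexbar) (hpexbar : 0 ≤ pexbar)
    -- L-G1 ∕ L-G2 DISCHARGED
    (ha₁ : 0 ≤ a₁) (hκ : 0 ≤ κ) (hκd : κ ≤ d₁)
    -- L-R1
    (hρ : ∀ (k : ℕ) (P P' : ι → ℝ) (M : ℝ), (∀ y, |P y - P' y| ≤ wt k y * M) → ‖ρ k P - ρ k P'‖ ≤ M)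
    -- L-R2 REPLACED by the size-induction data (B0), (X), (N), (R′)
    (hexplSize : ∀ g ∈ W, ∀ (k : ℕ) (U : Bg) (X : C.Dom), C.scale X = k + 1 →
      |expl k (g k) U X| ≤ Real.exp (-(κ * C.d X)) * p₀ k)
    (hbase : ∀ g ∈ W, ∀ (U : Bg) (X : C.Dom), C.scale X = 0 → |E g U X| ≤ Real.exp (-(κ * C.d X)) * N 0)
    (hNsucc : ∀ j, p₀ j + a₁ ≤ N (j + 1)) (hNnn : ∀ j, 0 ≤ N j)
    (hbox : ∀ (k : ℕ) (P : ι → ℝ), (∀ y, |P y| ≤ wt k y * sizeRadius τ N k) → ρ k P ∈ 𝒜 k)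
    -- L-N1
    (hτbar : 0 ≤ τbar) (hω : 0 ≤ ω) (hpos : 0 < ω + 4 * lipbar * a₁ * τbar) :
    TermSize E W κ N ∧
      NE9 E W κ (prodModuli (4 * clipbar * a₁ + pexbar + 4 * lipbar * a₁ * qTbar) fun _ => ω + 4 * lipbar * a₁ * τbar) ∧
        FadingMemory ((4 * clipbar * a₁ + pexbar + 4 * lipbar * a₁ * qTbar) / (ω + 4 * lipbar * a₁ * τbar))
          (ω + 4 * lipbar * a₁ * τbar)
          (prodModuli (4 * clipbar * a₁ + pexbar + 4 * lipbar * a₁ * qTbar) fun _ => ω + 4 * lipbar * a₁ * τbar) :=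
  ne9_and_fadingMemory_of_couplingTwoPoint_sizeInduction Γ.geom ρ expl h0 hAdm hres hadd hsum hstep hfac hclip0 hCup hqT0 hTcup
    hrepr hexpl hclipb hpexb hpexbar hqTb hK (Γ.decayExtract (hκ.trans hκd)) (Γ.pinBudget ha₁ hκ hκd) hρ hexplSize hbase hNsucc
    hNnn hbox ha₁ hlipb hτbar hω hpos hτ

/-- **END-S OVER A CUBE CHART (vacuum-subtracted representation)** [bookkeeping] —
`NE9BridgeSizeInduction.ne9_and_fadingMemory_of_couplingTwoPoint_vacSub_sizeInduction` at `Γ.geom` with cube-count size weights: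
L-G1∕L-G2 discharged, L-A4 gone, L-R2 replaced by (B0) `hbase`, (XZ) `hexplZ`, (N′) `hNsucc : p₀ j + 2·a₁ ≤ N (j+1)`, `hNnn`, (R′)
`hbox` — the face displaying NEITHER an explicit-part modulus NOR an occupation hypothesis NOR a geometry hypothesis. -/
theorem cubeChart_termSize_ne9_and_fadingMemory_of_couplingTwoPoint_vacSub_sizeInduction (Γ : CubeChart C α adj D) {ι : Type}
    {E : Functional C Bg} {W : Set (ℕ → ℝ)} {Adm : Set (Bg → C.Dom → ℝ)} {T : ℕ → (ℕ → ℝ) → (Bg → C.Dom → ℝ) → ι → ℝ}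
    {Ψ : ℕ → ℝ → (ι → ℝ) → Bg → C.Dom → ℝ} {act : ℕ → ℝ → Bg → Pot → Γ.geom.P → ℂ} {𝒜 : ℕ → Set Pot}
    {n : ℕ → ℝ → Bg → Γ.geom.P → ℝ} {lip clip : ℕ → ℝ}
    {a₁ d₁ κ lipbar clipbar qTbar τbar ω : ℝ} {wt : ℕ → ι → ℝ} {τ : ℕ → ℕ → ℝ} {qT p₀ N : ℕ → ℝ}
    (ρ : ℕ → (ι → ℝ) → Pot) (U₀ : Bg) (explZ : ℕ → Bg → C.Dom → ℝ)
    -- L-S1 … L-S4 (vacuum-subtracted representation)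
    (h0 : ScaleZeroFree E W) (hAdm : AdmissibleTerms E W Adm) (hres : AdmRestrict Adm)
    (hadd : ChannelAdditive Adm T) (hsum : ChannelStepSum Adm T) (hfac : Factorises E W T Ψ)
    (hreprV : ∀ (k : ℕ) (s : ℝ) (P : ι → ℝ) (U : Bg) (X : C.Dom),
      Ψ k s P U X = (Γ.geom.newTerm act k s U X (ρ k P)).re - (Γ.geom.newTerm act k s U₀ X (ρ k P)).re + explZ k U X)
    -- L-S5
    (hstep : ChannelSizeAtStepNN Adm T κ wt τ) (hτ : ∀ k j, j ≤ k → 0 ≤ τ k j ∧ τ k j ≤ τbar * ω ^ (k - j))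
    -- L-A1
    (hK : TwoPointKP Γ.geom W act 𝒜 n lip (Γ.supported.sizeWeight a₁) (Γ.supported.sizeWeight d₁))
    (hlipb : ∀ k, lip k ≤ lipbar)
    -- L-A2
    (hclip0 : ∀ k, 0 ≤ clip k)
    (hCup : ∀ g ∈ W, ∀ g' ∈ W, ∀ (k : ℕ) (U : Bg) (X : C.Dom), C.scale X = k + 1 → ∀ Q ∈ 𝒜 k, ∀ γ ∈ Γ.geom.vol X,
      ‖act k (g k) U Q γ‖ ≤ n k (g' k) U γ ∧
        ‖act k (g k) U Q γ - act k (g' k) U Q γ‖ ≤ clip k * |g k - g' k| * n k (g' k) U γ)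
    (hclipb : ∀ k, clip k ≤ clipbar)
    -- L-A3
    (hqT0 : ∀ k, 0 ≤ qT k)
    (hTcup : ∀ g ∈ W, ∀ g' ∈ W, ∀ (k : ℕ) (y : ι), |T k g (E g) y - T k g' (E g) y| ≤ wt k y * (qT k * |g k - g' k|))
    (hqTb : ∀ k, qT k ≤ qTbar)
    -- L-G1 ∕ L-G2 DISCHARGED
    (ha₁ : 0 ≤ a₁) (hκ : 0 ≤ κ) (hκd : κ ≤ d₁)
    -- L-R1
    (hρ : ∀ (k : ℕ) (P P' : ι → ℝ) (M : ℝ), (∀ y, |P y - P' y| ≤ wt k y * M) → ‖ρ k P - ρ k P'‖ ≤ M)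
    -- L-R2 REPLACED by (B0), (XZ), (N′), (R′)
    (hexplZ : ∀ (k : ℕ) (U : Bg) (X : C.Dom), C.scale X = k + 1 → |explZ k U X| ≤ Real.exp (-(κ * C.d X)) * p₀ k)
    (hbase : ∀ g ∈ W, ∀ (U : Bg) (X : C.Dom), C.scale X = 0 → |E g U X| ≤ Real.exp (-(κ * C.d X)) * N 0)
    (hNsucc : ∀ j, p₀ j + 2 * a₁ ≤ N (j + 1)) (hNnn : ∀ j, 0 ≤ N j)
    (hbox : ∀ (k : ℕ) (P : ι → ℝ), (∀ y, |P y| ≤ wt k y * sizeRadius τ N k) → ρ k P ∈ 𝒜 k)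
    -- L-N1
    (hτbar : 0 ≤ τbar) (hω : 0 ≤ ω) (hpos : 0 < ω + 8 * lipbar * a₁ * τbar) :
    TermSize E W κ N ∧
      NE9 E W κ (prodModuli (8 * clipbar * a₁ + 8 * lipbar * a₁ * qTbar) fun _ => ω + 8 * lipbar * a₁ * τbar) ∧
        FadingMemory ((8 * clipbar * a₁ + 8 * lipbar * a₁ * qTbar) / (ω + 8 * lipbar * a₁ * τbar))
          (ω + 8 * lipbar * a₁ * τbar)
          (prodModuli (8 * clipbar * a₁ + 8 * lipbar * a₁ * qTbar) fun _ => ω + 8 * lipbar * a₁ * τbar) :=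
  ne9_and_fadingMemory_of_couplingTwoPoint_vacSub_sizeInduction Γ.geom ρ U₀ explZ h0 hAdm hres hadd hsum hstep hfac hclip0 hCup
    hqT0 hTcup hreprV hclipb hqTb hK (Γ.decayExtract (hκ.trans hκd)) (Γ.pinBudget ha₁ hκ hκd) hρ hexplZ hbase hNsucc hNnn hbox
    ha₁ hlipb hτbar hω hpos hτ

end AnyChart

/-! ## §2 ON THE CARRIERS OF RECORD: `Γ := B13CarriersCubeChart.cubeChart R`, `R : B13Carriers.TwoRuns G` -/

section Record

variable {Gg : Type} [GaugeGroup Gg] (R : TwoRuns Gg) {Bg : Type} {Pot : Type*} [NormedAddCommGroup Pot] [NormedSpace ℂ Pot]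

/-- **END-B ON THE CARRIERS OF RECORD** [bookkeeping] — §1's END-B face at NE9's cube chart `cubeChart R` of the two-run carriers
`R.carriers` (cubes = embedded footprints, adjacency `SAdj R` of degree `8`, `d ≤ #cubes` from `TwoRuns.d_le_card_sub_one`): for
every term functional `E : Functional R.carriers Bg` — the SAME `Carriers` as row NE5's END faces — END-B's conclusion with the
geometry leaves L-G1∕L-G2 inhabited; pin budget `B = a₁`.  Every analytic∕structural binder displayed verbatim on the model O1. -/
theorem rec_ne9_and_fadingMemory_of_couplingTwoPoint {ι : Type} {E : Functional R.carriers Bg}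
    {W : Set (ℕ → ℝ)} {Adm : Set (Bg → R.carriers.Dom → ℝ)} {T : ℕ → (ℕ → ℝ) → (Bg → R.carriers.Dom → ℝ) → ι → ℝ}
    {Ψ : ℕ → ℝ → (ι → ℝ) → Bg → R.carriers.Dom → ℝ} {act : ℕ → ℝ → Bg → Pot → (cubeChart R).geom.P → ℂ}
    {𝒜 : ℕ → Set Pot} {n : ℕ → ℝ → Bg → (cubeChart R).geom.P → ℝ} {lip clip : ℕ → ℝ}
    {a₁ d₁ κ lipbar clipbar pexbar qTbar τbar ω : ℝ} {wt : ℕ → ι → ℝ} {τ : ℕ → ℕ → ℝ} {pex qT : ℕ → ℝ}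
    (ρ : ℕ → (ι → ℝ) → Pot) (expl : ℕ → ℝ → Bg → R.carriers.Dom → ℝ)
    -- L-S1 … L-S4
    (h0 : ScaleZeroFree E W) (hAdm : AdmissibleTerms E W Adm) (hres : AdmRestrict Adm)
    (hadd : ChannelAdditive Adm T) (hsum : ChannelStepSum Adm T) (hfac : Factorises E W T Ψ)
    (hrepr : ∀ (k : ℕ) (s : ℝ) (P : ι → ℝ) (U : Bg) (X : R.carriers.Dom),
      Ψ k s P U X = ((cubeChart R).geom.newTerm act k s U X (ρ k P)).re + expl k s U X)
    -- L-S5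
    (hstep : ChannelSizeAtStepNN Adm T κ wt τ) (hτ : ∀ k j, j ≤ k → 0 ≤ τ k j ∧ τ k j ≤ τbar * ω ^ (k - j))
    -- L-A1
    (hK : TwoPointKP (cubeChart R).geom W act 𝒜 n lip ((cubeChart R).supported.sizeWeight a₁)
      ((cubeChart R).supported.sizeWeight d₁))
    (hlipb : ∀ k, lip k ≤ lipbar)
    -- L-A2
    (hclip0 : ∀ k, 0 ≤ clip k)
    (hCup : ∀ g ∈ W, ∀ g' ∈ W, ∀ (k : ℕ) (U : Bg) (X : R.carriers.Dom), R.carriers.scale X = k + 1 → ∀ Q ∈ 𝒜 k,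
      ∀ γ ∈ (cubeChart R).geom.vol X,
        ‖act k (g k) U Q γ‖ ≤ n k (g' k) U γ ∧
          ‖act k (g k) U Q γ - act k (g' k) U Q γ‖ ≤ clip k * |g k - g' k| * n k (g' k) U γ)
    (hclipb : ∀ k, clip k ≤ clipbar)
    -- L-A3
    (hqT0 : ∀ k, 0 ≤ qT k)
    (hTcup : ∀ g ∈ W, ∀ g' ∈ W, ∀ (k : ℕ) (y : ι), |T k g (E g) y - T k g' (E g) y| ≤ wt k y * (qT k * |g k - g' k|))
    (hqTb : ∀ k, qT k ≤ qTbar)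
    -- L-A4
    (hexpl : ∀ g ∈ W, ∀ g' ∈ W, ∀ (k : ℕ) (U : Bg) (X : R.carriers.Dom), R.carriers.scale X = k + 1 →
      |expl k (g k) U X - expl k (g' k) U X| ≤ Real.exp (-(κ * R.carriers.d X)) * (pex k * |g k - g' k|))
    (hpexb : ∀ k, pex k ≤ pexbar) (hpexbar : 0 ≤ pexbar)
    -- L-G1 ∕ L-G2 INHABITED on the carriers of record: three scalars
    (ha₁ : 0 ≤ a₁) (hκ : 0 ≤ κ) (hκd : κ ≤ d₁)
    -- L-R1, L-R2, L-N1
    (hρ : ∀ (k : ℕ) (P P' : ι → ℝ) (M : ℝ), (∀ y, |P y - P' y| ≤ wt k y * M) → ‖ρ k P - ρ k P'‖ ≤ M)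
    (hocc : ∀ g ∈ W, ∀ g' ∈ W, ∀ k : ℕ, ρ k (T k g' (E g)) ∈ 𝒜 k)
    (hτbar : 0 ≤ τbar) (hω : 0 ≤ ω) (hpos : 0 < ω + 4 * lipbar * a₁ * τbar) :
    NE9 E W κ (prodModuli (4 * clipbar * a₁ + pexbar + 4 * lipbar * a₁ * qTbar) fun _ => ω + 4 * lipbar * a₁ * τbar) ∧
      FadingMemory ((4 * clipbar * a₁ + pexbar + 4 * lipbar * a₁ * qTbar) / (ω + 4 * lipbar * a₁ * τbar))
        (ω + 4 * lipbar * a₁ * τbar)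
        (prodModuli (4 * clipbar * a₁ + pexbar + 4 * lipbar * a₁ * qTbar) fun _ => ω + 4 * lipbar * a₁ * τbar) :=
  cubeChart_ne9_and_fadingMemory_of_couplingTwoPoint (cubeChart R) ρ expl h0 hAdm hres hadd hsum hfac hrepr hstep hτ hK hlipb
    hclip0 hCup hclipb hqT0 hTcup hqTb hexpl hpexb hpexbar ha₁ hκ hκd hρ hocc hτbar hω hpos

/-- **END-S ON THE CARRIERS OF RECORD (vacuum-subtracted representation)** [bookkeeping] — §1's fourth face at `cubeChart R`: on
`R.carriers`, NE9 ∧ FadingMemory ∧ the term size bound with NO geometry hypothesis, NO explicit-part modulus and NO occupation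
hypothesis displayed — what remains is the model O1 (L-O1, L-S1…L-S5, L-R1), the analytic leaves L-A1…L-A3, the one-run size data
(B0)∕(XZ)∕(N′)∕(R′) and the symbolic scalars (L-N1, c6). -/
theorem rec_termSize_ne9_and_fadingMemory_of_couplingTwoPoint_vacSub_sizeInduction {ι : Type} {E : Functional R.carriers Bg}
    {W : Set (ℕ → ℝ)} {Adm : Set (Bg → R.carriers.Dom → ℝ)} {T : ℕ → (ℕ → ℝ) → (Bg → R.carriers.Dom → ℝ) → ι → ℝ}
    {Ψ : ℕ → ℝ → (ι → ℝ) → Bg → R.carriers.Dom → ℝ} {act : ℕ → ℝ → Bg → Pot → (cubeChart R).geom.P → ℂ}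
    {𝒜 : ℕ → Set Pot} {n : ℕ → ℝ → Bg → (cubeChart R).geom.P → ℝ} {lip clip : ℕ → ℝ}
    {a₁ d₁ κ lipbar clipbar qTbar τbar ω : ℝ} {wt : ℕ → ι → ℝ} {τ : ℕ → ℕ → ℝ} {qT p₀ N : ℕ → ℝ}
    (ρ : ℕ → (ι → ℝ) → Pot) (U₀ : Bg) (explZ : ℕ → Bg → R.carriers.Dom → ℝ)
    -- L-S1 … L-S4 (vacuum-subtracted representation)
    (h0 : ScaleZeroFree E W) (hAdm : AdmissibleTerms E W Adm) (hres : AdmRestrict Adm)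
    (hadd : ChannelAdditive Adm T) (hsum : ChannelStepSum Adm T) (hfac : Factorises E W T Ψ)
    (hreprV : ∀ (k : ℕ) (s : ℝ) (P : ι → ℝ) (U : Bg) (X : R.carriers.Dom),
      Ψ k s P U X = ((cubeChart R).geom.newTerm act k s U X (ρ k P)).re -
        ((cubeChart R).geom.newTerm act k s U₀ X (ρ k P)).re + explZ k U X)
    -- L-S5
    (hstep : ChannelSizeAtStepNN Adm T κ wt τ) (hτ : ∀ k j, j ≤ k → 0 ≤ τ k j ∧ τ k j ≤ τbar * ω ^ (k - j))
    -- L-A1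
    (hK : TwoPointKP (cubeChart R).geom W act 𝒜 n lip ((cubeChart R).supported.sizeWeight a₁)
      ((cubeChart R).supported.sizeWeight d₁))
    (hlipb : ∀ k, lip k ≤ lipbar)
    -- L-A2
    (hclip0 : ∀ k, 0 ≤ clip k)
    (hCup : ∀ g ∈ W, ∀ g' ∈ W, ∀ (k : ℕ) (U : Bg) (X : R.carriers.Dom), R.carriers.scale X = k + 1 → ∀ Q ∈ 𝒜 k,
      ∀ γ ∈ (cubeChart R).geom.vol X,
        ‖act k (g k) U Q γ‖ ≤ n k (g' k) U γ ∧
          ‖act k (g k) U Q γ - act k (g' k) U Q γ‖ ≤ clip k * |g k - g' k| * n k (g' k) U γ)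
    (hclipb : ∀ k, clip k ≤ clipbar)
    -- L-A3
    (hqT0 : ∀ k, 0 ≤ qT k)
    (hTcup : ∀ g ∈ W, ∀ g' ∈ W, ∀ (k : ℕ) (y : ι), |T k g (E g) y - T k g' (E g) y| ≤ wt k y * (qT k * |g k - g' k|))
    (hqTb : ∀ k, qT k ≤ qTbar)
    -- L-G1 ∕ L-G2 INHABITED on the carriers of record
    (ha₁ : 0 ≤ a₁) (hκ : 0 ≤ κ) (hκd : κ ≤ d₁)
    -- L-R1
    (hρ : ∀ (k : ℕ) (P P' : ι → ℝ) (M : ℝ), (∀ y, |P y - P' y| ≤ wt k y * M) → ‖ρ k P - ρ k P'‖ ≤ M)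
    -- (B0), (XZ), (N′), (R′)
    (hexplZ : ∀ (k : ℕ) (U : Bg) (X : R.carriers.Dom), R.carriers.scale X = k + 1 →
      |explZ k U X| ≤ Real.exp (-(κ * R.carriers.d X)) * p₀ k)
    (hbase : ∀ g ∈ W, ∀ (U : Bg) (X : R.carriers.Dom), R.carriers.scale X = 0 →
      |E g U X| ≤ Real.exp (-(κ * R.carriers.d X)) * N 0)
    (hNsucc : ∀ j, p₀ j + 2 * a₁ ≤ N (j + 1)) (hNnn : ∀ j, 0 ≤ N j)
    (hbox : ∀ (k : ℕ) (P : ι → ℝ), (∀ y, |P y| ≤ wt k y * sizeRadius τ N k) → ρ k P ∈ 𝒜 k)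
    -- L-N1
    (hτbar : 0 ≤ τbar) (hω : 0 ≤ ω) (hpos : 0 < ω + 8 * lipbar * a₁ * τbar) :
    TermSize E W κ N ∧
      NE9 E W κ (prodModuli (8 * clipbar * a₁ + 8 * lipbar * a₁ * qTbar) fun _ => ω + 8 * lipbar * a₁ * τbar) ∧
        FadingMemory ((8 * clipbar * a₁ + 8 * lipbar * a₁ * qTbar) / (ω + 8 * lipbar * a₁ * τbar))
          (ω + 8 * lipbar * a₁ * τbar)
          (prodModuli (8 * clipbar * a₁ + 8 * lipbar * a₁ * qTbar) fun _ => ω + 8 * lipbar * a₁ * τbar) :=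
  cubeChart_termSize_ne9_and_fadingMemory_of_couplingTwoPoint_vacSub_sizeInduction (cubeChart R) ρ U₀ explZ h0 hAdm hres hadd
    hsum hfac hreprV hstep hτ hK hlipb hclip0 hCup hclipb hqT0 hTcup hqTb ha₁ hκ hκd hρ hexplZ hbase hNsucc hNnn hbox hτbar hω hpos

end Record

end Summit.QuantumFields.BalabanUV.T4Continuum.NE9.CarriersOfRecordFaces

end
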